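import Literature.AnabelianGeometry.EtaleTheta.SettingModelSlice2AxisPinning
import HarnessLib

/-!
# (L3′) slice 2, file 8/13 — `AxisPinned`: exactness of the unipotent law, `Ψ′ = id` on axis cusps, `A`, `b^t`; `Û′ = Û`

Part of the (L3′) slice-2 chain (abc-iut-L6-t19; FILING SHAPE derived from scratch v5 `Slice2TheoremR2ScratchV5.lean`
551b982286441a66 by the edits E1–E4/D1–D3/H1–H2 of FILING-PLAN-SLICE2.md 9643c7e42a42ad24 and the OPTION-L re-cut of §F v1.19gz (W):
one definitions file + twelve theorem files).  Classical profinite group theory about OUR semi-synthetic `F₂hatT`; the objects and laws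
are those of the one-sentence residual of record (cf. [EtTh] §1, §2 for the role they play there — nothing of [EtTh]/[IUTchII]/[IUTchIII]
in print is asserted; no side on [IUTchIII] Cor. 3.12; MORATORIUM (E): no application to `hext_at_iff_exists_f2hatAut_of_eq`).
-/

noncomputable section

open scoped Pointwise

namespace Literature.AnabelianGeometry.EtaleTheta.SettingModel.Slice2

open Literature.AnabelianGeometry.EtaleTheta.SettingModel
open Literature.AnabelianGeometry.EtaleTheta (ZHatLevel.level ZHatLevel.levelChar)
open Literature.AnabelianGeometry.SemiGraphs (GQp)
open Literature.AnabelianGeometry.AbsoluteAnabelian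
open Literature.AnabelianGeometry.AbsoluteAnabelian.AbsTopII
open _root_.Topology

/-! ## §12 THE PINNED AXIS (normalised case `s(1) = 1`): exactness of the unipotent law, `Ψ′ = id` on every
axis cusp group and on `B`, `Ψ′(A) = A`, `f′` normalises `Û_l` -/

section Pinned

variable {p : ℕ} [Fact p.Prime] {l : ℕ+} {U₀ : Subgroup (GQp p)} {m : ℕ+} {f' : F₂hatT} {Ψ : F₂hatT → F₂hatT}

/-- `w² = 1 → w = 1` in `Ẑ`. [cite: RibesZalesskii2010, Thm 2.7.1] -/
theorem zh_eq_one_of_sq (w : ZH) (h : w * w = 1) : w = 1 :=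
  ZHatCompletion.eq_one_of_pow_eq_one (n := 2) (by norm_num) (by rw [pow_two, h])

/-- **EXACTNESS** (case `s(i) = i`): for every `t ∈ mẐ` the cocycle value with `Ψ′(D′_t x) = e D′_t(Ψ′x) e⁻¹`
satisfies `Ψ′(d_{i,t}) = e · d_{i,t}` for all `i ∈ ℤ` — the intersection `d_i L_i ∩ d_{i+1} L_{i+1}` is the single
point `d_i` (`B ∩ aBa⁻¹ = 1`). [cite: MochizukiEtTh2009, §1 p.12] -/
theorem Residual.psi_dElt_eq (h : Residual p l U₀ m f' Ψ) [U₀.FiniteIndex]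
    (hline : ∀ i : ℤ, h.line i = ZHatLevel.eta i) (k : ZH) {e : F₂hatT}
    (he : ∀ x ∈ Uhat l, Ψ (Dp (k ^ (m : ℕ)) x) = e * Dp (k ^ (m : ℕ)) (Ψ x) * e⁻¹) (i : ℤ) :
    Ψ (dElt (ZHatLevel.eta i) (k ^ (m : ℕ))) = e * dElt (ZHatLevel.eta i) (k ^ (m : ℕ)) := by
  set t := k ^ (m : ℕ) with ht
  have htl : ZHatLevel.level l t = 1 := level_pow_eq_one_of_dvd h.dvd k
  obtain ⟨μ₁, hψ₁, hμ₁⟩ := h.psi_cusp i (kappa_mem_Uhat i) (bPow_eta_l_ne_one l)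
  obtain ⟨μ₂, hψ₂, hμ₂⟩ := h.psi_cusp (i + 1) (kappa_mem_Uhat (i + 1)) (bPow_eta_l_ne_one l)
  rw [hline] at hψ₁ hψ₂
  obtain ⟨w₁, hw₁⟩ := h.exists_psi_dElt htl (kappa_mem_Uhat i) (conj_betaPow_mem_vertGp (ZHatLevel.eta i) _) hμ₁ hψ₁ he
  have hP : (aPow (ZHatLevel.eta i))⁻¹ * betaPow (ZHatLevel.eta (i + 1)) (ZHatLevel.eta (l : ℤ)) *
      aPow (ZHatLevel.eta i) ∈ DehnTwist.vertGp := by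
    rw [eta_succ]; exact conj_betaPow_succ_mem_vertGp _ _
  obtain ⟨w₂, hw₂⟩ := h.exists_psi_dElt htl (kappa_mem_Uhat (i + 1)) hP hμ₂ hψ₂ he
  -- `d_{i+1} = d_i β_{i+1}^{2t}`, so `β_i^{w₁} = β_{i+1}^{2t·w₂}`: both trivial
  rw [eta_succ, dElt_succ, ← eta_succ] at hw₂
  have hw₂' : Ψ (dElt (ZHatLevel.eta i) t) = e * dElt (ZHatLevel.eta i) t * betaPow (ZHatLevel.eta (i + 1)) (t * t * w₂) := by
    rw [hw₂, betaPow_mul (ZHatLevel.eta (i + 1)) (t * t) w₂]; simp only [mul_assoc]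
  have hcmp : betaPow (ZHatLevel.eta i) w₁ = betaPow (ZHatLevel.eta (i + 1)) (t * t * w₂) :=
    mul_left_cancel (hw₁.symm.trans hw₂')
  have hne : ZHatLevel.eta i ≠ ZHatLevel.eta (i + 1) := by
    intro h0
    rw [eta_succ] at h0
    have h1 : zOne = 1 := mul_eq_left.mp h0.symm
    exact bPow_eta_ne_one (k := 1) one_ne_zero (by rw [← zOne, h1]; exact map_one bPow)
  rw [hw₁, betaPow_eq_one_of_eq_of_ne hne hcmp, mul_one]

/-- **THE AXIS CUSPS `β_j^{2t}` ARE FIXED** (case `s(i) = i`), for every `j ∈ ℤ`, `t ∈ mẐ`.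
[cite: MochizukiEtTh2009, §1 p.12] -/
theorem Residual.psi_betaPow_sq (h : Residual p l U₀ m f' Ψ) [U₀.FiniteIndex]
    (hline : ∀ i : ℤ, h.line i = ZHatLevel.eta i) (k : ZH) (j : ℤ) :
    Ψ (betaPow (ZHatLevel.eta j) (k ^ (m : ℕ) * k ^ (m : ℕ))) = betaPow (ZHatLevel.eta j) (k ^ (m : ℕ) * k ^ (m : ℕ)) := by
  set t := k ^ (m : ℕ) with ht
  have htl : ZHatLevel.level l t = 1 := level_pow_eq_one_of_dvd h.dvd k
  obtain ⟨e, -, he⟩ := h.dlaw_bAxis k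
  rw [← ht] at he
  have h1 := h.psi_dElt_eq hline k he (j - 1)
  have h2 := h.psi_dElt_eq hline k he j
  rw [← ht] at h1 h2
  have hsucc : ZHatLevel.eta j = ZHatLevel.eta (j - 1) * zOne := by rw [← eta_succ, sub_add_cancel]
  have hd : dElt (ZHatLevel.eta j) t = dElt (ZHatLevel.eta (j - 1)) t * betaPow (ZHatLevel.eta j) (t * t) := by
    conv_lhs => rw [hsucc, dElt_succ, ← hsucc]
  have hβU : betaPow (ZHatLevel.eta j) (t * t) ∈ Uhat l :=
    betaPow_mem_Uhat_of_level_eq_one _ (by rw [map_mul, htl, mul_one])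
  rw [hd, h.mul _ (dElt_mem_Uhat htl) _ hβU, h1, mul_assoc] at h2
  exact mul_left_cancel (mul_left_cancel h2)

/-- **THE COCYCLE IS TRIVIAL AND `Ψ′(b^t) = b^t`** (case `s(i) = i`): from `Ψ′(d_{0,t}) = e_t b^t` and
`Ψ′(b^{2t}) = b^{2t}`: `e_t² = 1`, so `e_t = 1` (`Ẑ` is torsion-free). [cite: MochizukiEtTh2009, §1 p.12] -/
theorem Residual.dexact_of_line (h : Residual p l U₀ m f' Ψ) [U₀.FiniteIndex]
    (hline : ∀ i : ℤ, h.line i = ZHatLevel.eta i) (k : ZH) :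
    (∀ x ∈ Uhat l, Ψ (Dp (k ^ (m : ℕ)) x) = Dp (k ^ (m : ℕ)) (Ψ x)) ∧
      (∀ i : ℤ, Ψ (dElt (ZHatLevel.eta i) (k ^ (m : ℕ))) = dElt (ZHatLevel.eta i) (k ^ (m : ℕ))) ∧
      Ψ (bPow (k ^ (m : ℕ))) = bPow (k ^ (m : ℕ)) := by
  set t := k ^ (m : ℕ) with ht
  obtain ⟨e, heB, he⟩ := h.dlaw_bAxis k
  rw [← ht] at he
  have hd := h.psi_dElt_eq hline k he
  simp only [← ht] at hd
  -- at `i = 0`: `Ψ′(b^t) = e b^t`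
  have h0 : Ψ (bPow t) = e * bPow t := by
    have := hd 0
    rwa [show ZHatLevel.eta (0 : ℤ) = (1 : ZH) by rw [ZHatLevel.eta_eq_zpow, zpow_zero], dElt_one] at this
  -- `Ψ′(b^{2t}) = b^{2t}`
  have h2 : Ψ (bPow (t * t)) = bPow (t * t) := by
    have := h.psi_betaPow_sq hline k 0
    rwa [← ht, show ZHatLevel.eta (0 : ℤ) = (1 : ZH) by rw [ZHatLevel.eta_eq_zpow, zpow_zero], betaPow_zero] at this
  -- hence `e² = 1`, `e = 1`
  obtain ⟨w, rfl⟩ := (mem_bAxis_iff _).1 heB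
  have hw : bPow w = 1 := by
    rw [map_mul, h.mul _ (bPow_mem_Uhat t) _ (bPow_mem_Uhat t), h0] at h2
    have h2' : bPow (w * t * (w * t)) = bPow (t * t) := by simpa only [map_mul] using h2
    have h5 := bPow_injective h2'
    have e7 : w * t * (w * t) = w * w * (t * t) := by
      rw [mul_assoc, ← mul_assoc t w t, ZHatCompletion.mul_comm t w, mul_assoc w t t, ← mul_assoc]
    rw [e7] at h5
    have h6 : w * w = 1 := mul_right_cancel (h5.trans (one_mul _).symm)
    rw [zh_eq_one_of_sq w h6]; exact map_one bPow
  rw [hw] at he h0 hd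
  refine ⟨fun x hx => by rw [he x hx, one_mul, inv_one, mul_one], fun i => by rw [hd i, one_mul],
    by rw [h0, one_mul]⟩

/-- **`Ψ′(b^u) = b^u` for all `u`** (case `s(i) = i`): `m₀^m = (η1)^m` and torsion-freeness. [cite: MochizukiEtTh2009, §1 p.12] -/
theorem Residual.psi_bPow_eq (h : Residual p l U₀ m f' Ψ) [U₀.FiniteIndex]
    (hline : ∀ i : ℤ, h.line i = ZHatLevel.eta i) (u : ZH) : Ψ (bPow u) = bPow u := by
  obtain ⟨m₀, hm₀⟩ := h.exists_psi_eb
  have ht := (h.dexact_of_line hline zOne).2.2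
  rw [h.psi_bPow, hm₀, ← bPow_zmul, zmul_comm] at ht
  have e1 : zmul (zOne ^ (m : ℕ)) m₀ = m₀ ^ (m : ℕ) := by
    rw [← zpow_natCast, zOne, ← ZHatLevel.eta_eq_zpow, zmul_eta, zpow_natCast]
  rw [e1] at ht
  have h5 : m₀ ^ (m : ℕ) = zOne ^ (m : ℕ) := bPow_injective ht
  have hmm : m₀ = zOne := by
    have h1 : (m₀ * zOne⁻¹) ^ (m : ℕ) = 1 := by
      rw [(show Commute m₀ zOne⁻¹ from ZHatCompletion.mul_comm _ _).mul_pow, inv_pow, h5, mul_inv_cancel]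
    have := ZHatCompletion.eq_one_of_pow_eq_one m.ne_zero h1
    rwa [mul_inv_eq_one] at this
  rw [h.psi_bPow, hm₀, hmm, ← bPow_zmul, zOne_zmul]

/-- **EVERY AXIS CUSP IS FIXED** (case `s(i) = i`): `Ψ′(β_j^u) = β_j^u` whenever `β_j^u ∈ Û_l` — the image is
`β_j^μ` on the right line, and `(β_j^u)^{2m} = β_j^{u^m u^m}` is fixed, so `μ^{2m} = u^{2m}`, `μ = u`.
[cite: MochizukiEtTh2009, §1 p.12] -/
theorem Residual.psi_cusp_eq (h : Residual p l U₀ m f' Ψ) [U₀.FiniteIndex]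
    (hline : ∀ i : ℤ, h.line i = ZHatLevel.eta i) (j : ℤ) {u : ZH}
    (hu : betaPow (ZHatLevel.eta j) u ∈ Uhat l) : Ψ (betaPow (ZHatLevel.eta j) u) = betaPow (ZHatLevel.eta j) u := by
  by_cases h0 : bPow u = 1
  · have : betaPow (ZHatLevel.eta j) u = 1 := (betaPow_eq_one_iff _ _).2 ((bPow_eq_one_iff u).1 h0)
    rw [this, h.psi_one]
  obtain ⟨μ, hψ, hμ⟩ := h.psi_cusp j hu h0
  rw [hline] at hψ
  have hsq := h.psi_betaPow_sq hline u j
  have hpow : betaPow (ZHatLevel.eta j) (u ^ (m : ℕ) * u ^ (m : ℕ)) = betaPow (ZHatLevel.eta j) u ^ (2 * (m : ℕ)) := by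
    rw [betaPow_pow, two_mul, pow_add]
  rw [hpow, h.psi_pow hu, hψ, betaPow_pow, betaPow_pow] at hsq
  have h5 : μ ^ (2 * (m : ℕ)) = u ^ (2 * (m : ℕ)) := betaPow_right_injective _ hsq
  have h6 : (μ * u⁻¹) ^ (2 * (m : ℕ)) = 1 := by
    rw [(show Commute μ u⁻¹ from ZHatCompletion.mul_comm _ _).mul_pow, inv_pow, h5, mul_inv_cancel]
  have h7 : μ = u := by
    have := ZHatCompletion.eq_one_of_pow_eq_one (by positivity : 2 * (m : ℕ) ≠ 0) h6
    rwa [mul_inv_eq_one] at this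
  rw [hψ, h7]

/-- `a^{-r} β_s^t a^{r} = β_{r⁻¹ s}^t`. [cite: MochizukiEtTh2009, §1 p.12] -/
theorem aPow_inv_mul_betaPow_mul_aPow (r s t : ZH) : (aPow r)⁻¹ * betaPow s t * aPow r = betaPow (r⁻¹ * s) t := by
  rw [betaPow, betaPow, aPow_mul, aPow_inv]; group

/-- **`Ψ′(A) = A`** (case `s(i) = i`): `Ψ′(A) = a^ν` by Thm R1, and `κ_{−1} = A⁻¹ κ_{l−1} A` forces `ν = l`.
[cite: MochizukiEtTh2009, §1 p.12] -/
theorem Residual.psi_A_eq (h : Residual p l U₀ m f' Ψ) [U₀.FiniteIndex]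
    (hline : ∀ i : ℤ, h.line i = ZHatLevel.eta i) :
    Ψ (aPow (ZHatLevel.eta (l : ℤ))) = aPow (ZHatLevel.eta (l : ℤ)) := by
  obtain ⟨ν, hν⟩ := h.exists_psi_aPow (level_eta_self l)
  have hA : aPow (ZHatLevel.eta (l : ℤ)) ∈ Uhat l := (aPow_mem_Uhat_iff _).2 (level_eta_self l)
  -- `κ_{−1} = A⁻¹ κ_{l−1} A`
  have hrel : betaPow (ZHatLevel.eta (-1)) (ZHatLevel.eta (l : ℤ)) = (aPow (ZHatLevel.eta (l : ℤ)))⁻¹ *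
      betaPow (ZHatLevel.eta ((l : ℤ) - 1)) (ZHatLevel.eta (l : ℤ)) * aPow (ZHatLevel.eta (l : ℤ)) := by
    rw [aPow_inv_mul_betaPow_mul_aPow, eta_inv, eta_mul_eta]; congr 2; ring
  have h1 := congrArg Ψ hrel
  rw [h.psi_cusp_eq hline (-1) (kappa_mem_Uhat _), h.mul _ (mul_mem (inv_mem hA) (kappa_mem_Uhat _)) _ hA,
    h.mul _ (inv_mem hA) _ (kappa_mem_Uhat _), h.psi_inv hA, hν, h.psi_cusp_eq hline _ (kappa_mem_Uhat _),
    aPow_inv_mul_betaPow_mul_aPow] at h1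
  -- lines: `η(−1) = ν⁻¹ η(l−1)`
  have h2 : ZHatLevel.eta (-1) = ν⁻¹ * ZHatLevel.eta ((l : ℤ) - 1) :=
    eq_of_betaPow_commute (bPow_eta_l_ne_one l) (bPow_eta_l_ne_one l) (by rw [h1])
  have h3 : ν = ZHatLevel.eta (l : ℤ) := by
    rw [eq_inv_mul_iff_mul_eq] at h2
    -- h2 : ν * η(−1) = η(l−1)
    calc ν = ν * ZHatLevel.eta (-1) * (ZHatLevel.eta (-1))⁻¹ := by rw [mul_inv_cancel_right]
      _ = ZHatLevel.eta ((l : ℤ) - 1) * ZHatLevel.eta 1 := by rw [h2, eta_inv, neg_neg]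
      _ = ZHatLevel.eta (l : ℤ) := by rw [eta_mul_eta, sub_add_cancel]
  rw [hν, h3]

/-- Conjugation on the Heisenberg level: if `ĥ(f)` has `x = 0` then `f y f⁻¹ ∈ Û_l ↔ y ∈ Û_l`.
[cite: MochizukiEtTh2009, Def 2.5 (i) p.39] -/
theorem conj_mem_Uhat_iff_of_x_eq_zero {f : F₂hatT} (hf : (hHat l f).x = 0) (y : F₂hatT) :
    f * y * f⁻¹ ∈ Uhat l ↔ y ∈ Uhat l := by
  simp only [mem_Uhat_iff, map_mul, map_inv, Heis.mul_x, Heis.inv_x, Heis.mul_z, Heis.inv_z, hf,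
    zero_add, neg_zero, zero_mul, add_zero]
  constructor
  · rintro ⟨hx, hz⟩
    have hx' : (hHat l y).x = 0 := by simpa using hx
    refine ⟨hx', ?_⟩
    rw [hx'] at hz; simpa using hz
  · rintro ⟨hx, hz⟩
    refine ⟨by simpa using hx, ?_⟩
    rw [hx, hz]; simp

/-- **`Û′ = Û`** (case `s(i) = i`): `Ψ′(b) = b` forces `f′ b f′⁻¹ ∈ Û_l`, so `deg f′ ≡ 0 (mod l)`, so `f′`
normalises `Û_l`. [cite: MochizukiEtTh2009, §1 p.12] -/
theorem Residual.normal_of_line (h : Residual p l U₀ m f' Ψ) [U₀.FiniteIndex]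
    (hline : ∀ i : ℤ, h.line i = ZHatLevel.eta i) (y : F₂hatT) : f' * y * f'⁻¹ ∈ Uhat l ↔ y ∈ Uhat l := by
  have hb : f' * eb * f'⁻¹ ∈ Uhat l := by
    have := h.mapsTo eb eb_mem_Uhat
    have e : Ψ eb = eb := by
      have := h.psi_bPow_eq hline (iotaZ (Multiplicative.ofAdd 1))
      rwa [bPow_iotaZ_one] at this
    rwa [e] at this
  have hx : (hHat l f').x = 0 := by
    obtain ⟨-, hz⟩ := hb
    simp only [map_mul, map_inv, Heis.mul_z, Heis.inv_z, Heis.mul_x, Heis.inv_y,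
      hHat_eta, heisHom_of_one, Heis.map_apply] at hz
    simp at hz
    linear_combination hz
  exact conj_mem_Uhat_iff_of_x_eq_zero hx y

/-- **AXIS PINNED, normalised case**: if `s(1) = 1` then all of `AxisPinned` holds. [cite: MochizukiEtTh2009, §1 p.12] -/
theorem Residual.axisPinned_of_line_one (h : Residual p l U₀ m f' Ψ) [U₀.FiniteIndex]
    (h1 : h.line 1 = zOne) : AxisPinned p l U₀ m f' Ψ := by
  have hline := h.line_eq_eta h1
  exact
  { res := h
    dexact := fun k => (h.dexact_of_line hline k).1
    dElt_fixed := fun k => (h.dexact_of_line hline k).2.1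
    cusp_fixed := fun i u hu => h.psi_cusp_eq hline i hu
    bPow_fixed := h.psi_bPow_eq hline
    A_fixed := h.psi_A_eq hline
    normal := h.normal_of_line hline }

/-- **S1–S5 (THE AXIS), both signs**: either `Ψ′` itself or `σ̂ ∘ Ψ′` has its axis pinned (normalisation ε = ±1).
[cite: MochizukiEtTh2009, §1 p.12] -/
theorem Residual.axisPinned_or (h : Residual p l U₀ m f' Ψ) [U₀.FiniteIndex] :
    AxisPinned p l U₀ m f' Ψ ∨ AxisPinned p l U₀ m (sigmaHat f') (fun x => sigmaHat (Ψ x)) := by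
  rcases h.line_one_cases with h1 | h1
  · exact Or.inl (h.axisPinned_of_line_one h1)
  · right
    refine h.sigmaHat_comp.axisPinned_of_line_one ?_
    rw [h.sigmaHat_comp_line, h1, inv_inv]

end Pinned

end Literature.AnabelianGeometry.EtaleTheta.SettingModel.Slice2

end
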